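import Literature.Analysis.FluidPDE.LocalLerayBackwardUniquenessAnyDatum
import Literature.Analysis.FluidPDE.GKPRigidityBackwardUniqueness
import HarnessLib

/-!
# Backward uniqueness for local Leray solutions on a slab from the FAR FIELD of the final value
# (Lemarié-Rieusset 2016, Thm. 15.4, with the final value vanishing only outside a ball)

Analysis/FluidPDE proof file (theorems only: no definition, no named fact, no `sorry`).

The tree proves Lemarié-Rieusset's backward uniqueness theorem for local Leray solutions on a slab
with an arbitrary weakly divergence-free datum
(`IsLocalLeraySolutionOn.ae_zero_of_final_vanishing_unit_anyDatum`,
`LocalLerayBackwardUniquenessAnyDatum.lean`; P. G. Lemarié-Rieusset, *The Navier–Stokes Problem in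
the 21st Century* (2016), Thm. 15.4, along Escauriaza–Seregin–Šverák 2003, §5 / Seregin 2012, §4):
a local Leray solution `(v, π)` on `(0, T) × ℝ³` whose pairings with ALL test fields tend to `0`
as `t ↑ T` vanishes a.e. **On that route the vanishing of the final value is used at exactly one
place**: the far-field backward uniqueness of the vorticity (Escauriaza–Seregin–Šverák 2003, §3
(3.31)–(3.32) with the half-space theorem Thm. 5.1), which sees the final value only on the
exterior of a large ball; the remaining steps (the far-field `L^∞` bound Thm. 14.5, a.e. time is
regular by Caffarelli–Kohn–Nirenberg, bounded strips around regular times, spatial unique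
continuation of the vorticity, the Liouville theorem for bounded curl- and divergence-free fields
with the decay clause of the class) never look at the final value. This file records the resulting
FAR-FIELD form of Thm. 15.4:

* `localLeray_farField_curl_eq_zero_slab_of_farField_vanishing` — Steps 2–3 of the proof of
  Thm. 15.4 on a slab when the pairings `∫⟪u(t), φ⟫` tend to `0` as `t ↑ T₁` only for the test
  fields `φ` supported in `{|x| > R₁}`: the far-field vorticity of a representative vanishes on
  `(T₄, T₁) × {x₃ > R}`. Proof: the far-field representative `U` of the tree
  (`exists_farField_representative`, fed by `farField_bound_anyDatum`) on
  `(T₄, T₁) × {|x| > R}` with `R ≥ R₁ + 1`, and the general-frame backward-uniqueness step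
  `farField_curl_eq_zero_of_frame` (ESS §3 + Thm. 5.1, accepted) applied NOT to `u` but to the
  spatially cut-off field `ũ(t, x) = (1 − χ(x)) u(t, x)`, `χ` a smooth bump equal to `1` on
  `B̄(0, R − 1/2)` and supported in `B(0, R)`: `ũ = u = U` a.e. on the exterior region (the only
  place where the step compares `u` with `U`), and `∫⟪ũ(t), φ⟫ = ∫⟪u(t), (1 − χ)φ⟫ → 0` for EVERY
  test field `φ`, because `(1 − χ)φ` is a test field supported in `{|x| > R − 1/2} ⊆ {|x| > R₁}`.
* `IsLocalLeraySolutionOn.ae_zero_of_farField_final_vanishing_unit` /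
  `IsLocalLeraySolutionOn.ae_zero_of_farField_final_vanishing` — **Thm. 15.4 from the far field
  of the final value**: a local Leray solution on `(0, T) × ℝ³` (unit viscosity, resp. `ν > 0`)
  with weakly divergence-free datum whose pairings with the test fields supported in
  `{|x| > R₁}` tend to `0` as `t ↑ T` vanishes a.e. on the slab. Word for word the tree's
  `ae_zero_of_final_vanishing_unit_anyDatum` / `ae_zero_of_final_vanishing_anyDatum` with the
  far-field vorticity input replaced by the theorem above.

In words: **a local Leray solution whose final value vanishes near spatial infinity is trivial** —
equivalently, the final value of a nontrivial local Leray solution on a slab is never compactly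
supported (backward uniqueness "from spatial infinity"). Nothing accepted is restated or changed;
the theorems here are strict generalisations of the tree's (which they give back by forgetting the
support condition). Consumer: the crux `FiniteDissipationLiouville` of
`Summits/NavierStokesRegularity` (the distributional trace at the singular time of a singular
Type-I ancient solution with the quarter-rate dissipation law has unbounded support).

## Mathlib / tree search

`lean search 'farField_final|of_farField_vanishing|compactly supported final'`: nothing
(2026-08-28). Reused by name: `IsLocalLeraySolutionOn.farField_bound_anyDatum`,
`exists_farField_representative`, `farField_curl_eq_zero_of_frame`,
`NSBoundedHigherRegularityBounds_holds`, `kangMiuraTsai_local_pressure_bound_holds`,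
`ae_forall_isRegularPoint_slab`, `exists_strip_bound_Ioo`, `ae_zero_strip_of_farField_curl_eq_zero`,
`ae_norm_le_toReal_of_eLpNorm_top_lt_top`, `IsLocalLeraySolutionOn.toUnitViscosity`,
`ae_restrict_preimage_stAffine`, `stAffine_preimage_Ioo_zero_prod`; Mathlib's `ContDiffBump`.

## References

* P. G. Lemarié-Rieusset, *The Navier–Stokes Problem in the 21st Century*, CRC Press (2016),
  doi:10.1201/b19556: Thm. 15.4 (PDF p. 568) and its proof (pp. 568–569). [`LemarieRieusset2016`]
* L. Escauriaza, G. Seregin, V. Šverák, Russ. Math. Surveys 58:2 (2003) 211–250, §3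
  (3.31)–(3.32), Thm. 5.1, §5. [`EscauriazaSereginSverak2003`]
* G. Seregin, Comm. Math. Phys. 312 (2012) 833–845 = arXiv:1104.3615, §4. [`Seregin2012CMP`]
-/

noncomputable section

open MeasureTheory TopologicalSpace Set Function Filter Metric
open _root_.Topology
open scoped ENNReal NNReal InnerProductSpace RealInnerProductSpace ContDiff

namespace Literature.Analysis.FluidPDE

/-! ### A smooth far-field cutoff -/

/-- **The far-field cutoff of a test field is a test field supported in the far field.** For
`0 < r₁ < r₂` and the smooth bump `χ` (`= 1` on `B̄(0, r₁)`, supported in `B(0, r₂)`), the field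
`x ↦ (1 − χ x) • φ x` is a test field on `ℝ³` for every test field `φ`, it agrees with `φ` off
`B(0, r₂)`, and it vanishes on `B̄(0, r₁)`. [folklore] -/
private theorem isTestFunctionOn_farField_cutoff (χ : ContDiffBump (0 : EuclideanSpace ℝ (Fin 3)))
    {φ : EuclideanSpace ℝ (Fin 3) → EuclideanSpace ℝ (Fin 3)}
    (hφ : FunctionSpaces.IsTestFunctionOn (⊤ : Opens (EuclideanSpace ℝ (Fin 3))) φ) :
    FunctionSpaces.IsTestFunctionOn (⊤ : Opens (EuclideanSpace ℝ (Fin 3)))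
        (fun x => (1 - χ x) • φ x) ∧
      (∀ x, (1 - χ x) • φ x ≠ 0 → χ.rIn < ‖x‖) ∧
      (∀ x, χ.rOut ≤ ‖x‖ → (1 - χ x) • φ x = φ x) := by
  have hcd : ContDiff ℝ ∞ (fun x => 1 - χ x) := contDiff_const.sub χ.contDiff
  have hcs : HasCompactSupport (fun x => (1 - χ x) • φ x) :=
    hφ.hasCompactSupport.mono fun x hx => right_ne_zero_of_smul hx
  refine ⟨⟨hcd.smul hφ.contDiff, hcs, fun y _ => Opens.mem_top y⟩, fun x hx => ?_, fun x hx => ?_⟩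
  · by_contra hle
    push Not at hle
    have h1 : χ x = 1 := χ.one_of_mem_closedBall (by rwa [mem_closedBall, dist_zero_right])
    rw [h1, sub_self, zero_smul] at hx
    exact hx rfl
  · have h0 : χ x = 0 := χ.zero_of_le_dist (by rwa [dist_zero_right])
    rw [h0, sub_zero, one_smul]

/-! ### Steps 2–3 of the proof of Thm. 15.4 on a slab, final value vanishing in the far field -/

/-- **The far-field vorticity of a local Leray solution whose final value vanishes NEAR SPATIAL
INFINITY is zero** (Lemarié-Rieusset 2016, proof of Thm. 15.4, Steps 2–3, PDF pp. 568–569;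
Escauriaza–Seregin–Šverák 2003, §3 (3.31)–(3.32) with Thm. 5.1): for a local Leray solution
`(u, p)` on `(0, T₁) × ℝ³` with viscosity `ν > 0` and weakly divergence-free datum whose pairings
with the test fields SUPPORTED IN `{|x| > R₁}` tend to `0` as `t ↑ T₁`, and every
`T₄ ∈ (0, T₁)`, there are `R` and a representative `U` of `u` on `(T₄, T₁) × {x₃ > R}`, `C¹` in
space, with `curl U(t, ·) = 0` there. The far-field representative of the tree
(`exists_farField_representative` with `farField_bound_anyDatum`) on `(T₄, T₁) × {|x| > R}`,
`R ≥ R₁ + 1`, and the general-frame step `farField_curl_eq_zero_of_frame` applied to the cut-off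
field `(1 − χ) u` (`χ` a smooth bump, `= 1` on `B̄(0, R − 1/2)`, supported in `B(0, R)`), which
agrees with `U` a.e. on the exterior region and whose pairings with EVERY test field tend to `0`.
[cite: LemarieRieusset2016, proof of Thm. 15.4, Steps 2–3 (PDF pp. 568–569)] [cite: EscauriazaSereginSverak2003, §3 (3.31)–(3.32) and Thm. 5.1] -/
theorem localLeray_farField_curl_eq_zero_slab_of_farField_vanishing
    (hB : NSBoundedHigherRegularityBounds) {ν T₁ : ℝ} (hν : 0 < ν)
    {u₀ : EuclideanSpace ℝ (Fin 3) → EuclideanSpace ℝ (Fin 3)}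
    {u : ℝ → EuclideanSpace ℝ (Fin 3) → EuclideanSpace ℝ (Fin 3)}
    {p : ℝ → EuclideanSpace ℝ (Fin 3) → ℝ}
    (hdiv : IsWeaklyDivFree u₀) (hu : IsLocalLeraySolutionOn T₁ ν u₀ u p) {R₁ : ℝ}
    (hfinal : ∀ φ : EuclideanSpace ℝ (Fin 3) → EuclideanSpace ℝ (Fin 3),
      FunctionSpaces.IsTestFunctionOn (⊤ : Opens (EuclideanSpace ℝ (Fin 3))) φ →
        (∀ x, φ x ≠ 0 → R₁ < ‖x‖) →
        Tendsto (fun t => ∫ x, ⟪u t x, φ x⟫) (𝓝[<] T₁) (𝓝 0))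
    {T₄ : ℝ} (hT₄ : T₄ ∈ Ioo 0 T₁) :
    ∃ (R : ℝ) (U : ℝ → EuclideanSpace ℝ (Fin 3) → EuclideanSpace ℝ (Fin 3)),
      (∀ t ∈ Ioo T₄ T₁, ContDiffOn ℝ 1 (U t) {x : EuclideanSpace ℝ (Fin 3) | R < x 2}) ∧
        uncurry U =ᵐ[volume.restrict
          (Ioo T₄ T₁ ×ˢ {x : EuclideanSpace ℝ (Fin 3) | R < x 2})] uncurry u ∧
        ∀ t ∈ Ioo T₄ T₁, ∀ x : EuclideanSpace ℝ (Fin 3), R < x 2 → curl (U t) x = 0 := by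
  -- ### Step 2: the far-field bound and the far-field representative
  have ht₁ : (0 : ℝ) < T₄ / 2 := by linarith [hT₄.1]
  obtain ⟨R₀, hbd⟩ := hu.farField_bound_anyDatum hν ht₁ (le_refl T₁)
  set R : ℝ := max (max R₀ R₁) 0 + 1 with hRdef
  have hR₀R : R₀ < R := by
    rw [hRdef]; linarith [le_max_left R₀ R₁, le_max_left (max R₀ R₁) 0]
  have hR₁R : R₁ + 1 ≤ R := by
    rw [hRdef]; linarith [le_max_right R₀ R₁, le_max_left (max R₀ R₁) 0]
  have hR1 : (1 : ℝ) ≤ R := by rw [hRdef]; linarith [le_max_right (max R₀ R₁) 0]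
  have hRpos : 0 < R := by linarith
  obtain ⟨K, U, hae, -, hCD, hjc, hbdK⟩ := exists_farField_representative hB
    kangMiuraTsai_local_pressure_bound_holds hν hdiv hu ht₁ le_rfl hbd
    (by linarith [hT₄.1] : T₄ / 2 < T₄) hT₄.2 hR₀R 3
  set S : Set (EuclideanSpace ℝ (Fin 3)) := (closedBall (0 : EuclideanSpace ℝ (Fin 3)) R)ᶜ
    with hSdef
  have hSo : IsOpen S := isClosed_closedBall.isOpen_compl
  set Ω : Set (ℝ × EuclideanSpace ℝ (Fin 3)) := Ioo T₄ T₁ ×ˢ S with hΩdef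
  have hΩo : IsOpen Ω := isOpen_Ioo.prod hSo
  -- `(U, p)` solves the equations in `𝒟'(Ω)` with viscosity `ν`
  have hle : (⟨Ω, hΩo⟩ : Opens (ℝ × EuclideanSpace ℝ (Fin 3))) ≤
      slab (EuclideanSpace ℝ (Fin 3)) (Ioo 0 T₁) isOpen_Ioo := fun w hw =>
    mem_slab.2 ⟨hT₄.1.trans hw.1.1, hw.1.2⟩
  have hsolU : IsDistributionalNSSolutionOn ⟨Ω, hΩo⟩ ν 0 U p :=
    (hu.distributional.of_le hle).congr_ae hae.symm (ae_of_all _ fun _ => rfl)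
  -- ### the cut-off field `ũ = (1 − χ) u`, `χ = 1` on `B̄(0, R − 1/2)`, `supp χ ⊆ B(0, R)`
  let χ : ContDiffBump (0 : EuclideanSpace ℝ (Fin 3)) :=
    ⟨R - 1 / 2, R, by linarith [hR1], by linarith⟩
  have hχin : χ.rIn = R - 1 / 2 := rfl
  have hχout : χ.rOut = R := rfl
  set ut : ℝ → EuclideanSpace ℝ (Fin 3) → EuclideanSpace ℝ (Fin 3) :=
    fun t x => (1 - χ x) • u t x with hutdef
  -- `U = ũ` a.e. on `Ω` (there `χ = 0`)
  have hae' : uncurry U =ᵐ[volume.restrict Ω] uncurry ut := by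
    have hmem : ∀ᵐ z ∂(volume.restrict Ω), z ∈ Ω := ae_restrict_mem hΩo.measurableSet
    filter_upwards [hae, hmem] with z hz hzΩ
    have hxS : R < ‖z.2‖ := by
      have h := hzΩ.2
      rw [hSdef, mem_compl_iff, mem_closedBall, dist_zero_right, not_le] at h
      exact h
    have h0 : χ z.2 = 0 := χ.zero_of_le_dist (by rw [dist_zero_right, hχout]; exact hxS.le)
    rw [hz]
    show u z.1 z.2 = (1 - χ z.2) • u z.1 z.2
    rw [h0, sub_zero, one_smul]
  -- the pairings of `ũ` with EVERY test field tend to `0`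
  have hfinal' : ∀ φ : EuclideanSpace ℝ (Fin 3) → EuclideanSpace ℝ (Fin 3),
      FunctionSpaces.IsTestFunctionOn (⊤ : Opens (EuclideanSpace ℝ (Fin 3))) φ →
        Tendsto (fun t => ∫ x, ⟪ut t x, φ x⟫) (𝓝[<] T₁) (𝓝 0) := by
    intro φ hφ
    obtain ⟨hψ, hψsupp, -⟩ := isTestFunctionOn_farField_cutoff χ hφ
    have hψfar : ∀ x, (1 - χ x) • φ x ≠ 0 → R₁ < ‖x‖ := fun x hx => by
      have h := hψsupp x hx
      rw [hχin] at h
      linarith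
    refine (hfinal _ hψ hψfar).congr fun t => ?_
    refine integral_congr_ae (ae_of_all _ fun x => ?_)
    show ⟪u t x, (1 - χ x) • φ x⟫ = ⟪(1 - χ x) • u t x, φ x⟫
    rw [real_inner_smul_right, real_inner_smul_left]
  -- ### Step 3: the far-field backward-uniqueness step in the frame `(T₄, T₁) × {|x| > R}`
  have hzero : ∀ t ∈ Ioo T₄ T₁, ∀ x : EuclideanSpace ℝ (Fin 3),
      R + Real.sqrt (ν * (T₁ - T₄)) < ‖x‖ → curl (U t) x = 0 :=
    farField_curl_eq_zero_of_frame hν hT₄.2 hRpos.le hfinal' hae' hsolU hCD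
      (fun n _ => hjc n) hbdK
  -- ### the half-space form `{x₃ > R + √(ν (T₁ - T₄))}`
  have hcoord : ∀ x : EuclideanSpace ℝ (Fin 3), x 2 ≤ ‖x‖ := fun x => by
    have h := PiLp.norm_apply_le x (2 : Fin 3)
    rw [Real.norm_eq_abs] at h
    exact (le_abs_self _).trans h
  have hγ : 0 ≤ Real.sqrt (ν * (T₁ - T₄)) := Real.sqrt_nonneg _
  have hSof : ∀ x : EuclideanSpace ℝ (Fin 3), R + Real.sqrt (ν * (T₁ - T₄)) < x 2 → x ∈ S :=
    fun x hx => by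
      rw [hSdef, mem_compl_iff, mem_closedBall, dist_zero_right, not_le]
      linarith [hcoord x]
  refine ⟨R + Real.sqrt (ν * (T₁ - T₄)), U, fun t ht => ?_, ?_, fun t ht x hx => ?_⟩
  · -- `C¹` slices on the half-space region
    have hUS : ContDiffOn ℝ 1 (U t) S := fun x hx =>
      ((hCD (t, x) ⟨ht, hx⟩).of_le (by exact_mod_cast le_top)).contDiffWithinAt
    exact hUS.mono fun x hx => hSof x hx
  · -- the a.e. identity on the smaller region
    exact ae_restrict_of_ae_restrict_of_subset (prod_mono Subset.rfl fun x hx => hSof x hx) hae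
  · exact hzero t ht x (lt_of_lt_of_le hx (hcoord x))

/-! ### Thm. 15.4 on a slab from the far field of the final value -/

/-- **Backward uniqueness for slab local Leray solutions from the far field of the final value,
unit viscosity** (Lemarié-Rieusset 2016, Thm. 15.4, through Escauriaza–Seregin–Šverák 2003, §5 and
Seregin 2012, §4; the final value is required to vanish only outside a ball): a local Leray
solution `(v, π)` on `(0, T) × ℝ³` at unit viscosity with weakly divergence-free datum, whose
pairings with the test fields supported in `{|x| > R₁}` tend to `0` as `t ↑ T`, vanishes a.e. on
the slab. Word for word the tree's `IsLocalLeraySolutionOn.ae_zero_of_final_vanishing_unit_anyDatum`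
(a.e. time is regular by CKN, bounded strips around regular times,
`ae_zero_strip_of_farField_curl_eq_zero` on each, countably many strips), with the far-field
vorticity input `localLeray_farField_curl_eq_zero_slab_of_farField_vanishing`.
[cite: LemarieRieusset2016, Thm. 15.4 (PDF p. 568)] [cite: EscauriazaSereginSverak2003, §5] [cite: Seregin2012CMP, §4] -/
theorem IsLocalLeraySolutionOn.ae_zero_of_farField_final_vanishing_unit {T : ℝ} (hT : 0 < T)
    {u₀ : EuclideanSpace ℝ (Fin 3) → EuclideanSpace ℝ (Fin 3)}
    {v : ℝ → EuclideanSpace ℝ (Fin 3) → EuclideanSpace ℝ (Fin 3)}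
    {π : ℝ → EuclideanSpace ℝ (Fin 3) → ℝ}
    (hdiv : IsWeaklyDivFree u₀) (hv : IsLocalLeraySolutionOn T 1 u₀ v π) {R₁ : ℝ}
    (hfinal : ∀ φ : EuclideanSpace ℝ (Fin 3) → EuclideanSpace ℝ (Fin 3),
      FunctionSpaces.IsTestFunctionOn (⊤ : Opens (EuclideanSpace ℝ (Fin 3))) φ →
        (∀ x, φ x ≠ 0 → R₁ < ‖x‖) →
        Tendsto (fun t => ∫ x, ⟪v t x, φ x⟫) (𝓝[<] T) (𝓝 0)) :
    ∀ᵐ z ∂(volume.restrict (Ioo 0 T ×ˢ (univ : Set (EuclideanSpace ℝ (Fin 3))))),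
      v z.1 z.2 = 0 := by
  -- it suffices to treat the slabs `(T₄, T) × ℝ³`, `T₄ = T/(n+2)`
  suffices hmain : ∀ T₄ ∈ Ioo 0 T,
      ∀ᵐ z ∂(volume.restrict (Ioo T₄ T ×ˢ (univ : Set (EuclideanSpace ℝ (Fin 3))))),
        v z.1 z.2 = 0 by
    have hn : ∀ n : ℕ, ∀ᵐ z ∂(volume.restrict
        (Ioo (T / (n + 2)) T ×ˢ (univ : Set (EuclideanSpace ℝ (Fin 3))))), v z.1 z.2 = 0 :=
      fun n => hmain _ ⟨by positivity, div_lt_self hT (by norm_cast; omega)⟩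
    have hU : Ioo 0 T ×ˢ (univ : Set (EuclideanSpace ℝ (Fin 3))) =
        ⋃ n : ℕ, Ioo (T / (n + 2)) T ×ˢ (univ : Set (EuclideanSpace ℝ (Fin 3))) := by
      ext ⟨t, x⟩
      simp only [mem_prod, mem_Ioo, mem_univ, and_true, mem_iUnion]
      constructor
      · rintro ⟨ht0, htT⟩
        obtain ⟨n, hn⟩ := exists_nat_gt (T / t)
        refine ⟨n, ?_, htT⟩
        have h1 : T < (n : ℝ) * t := (div_lt_iff₀ ht0).1 hn
        rw [div_lt_iff₀ (by positivity)]
        nlinarith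
      · rintro ⟨n, h1, h2⟩
        exact ⟨lt_trans (by positivity) h1, h2⟩
    rw [hU, ae_restrict_iUnion_iff]
    exact hn
  intro T₄ hT₄
  have hI₄ : Ioo T₄ T ⊆ Ioo 0 T := Ioo_subset_Ioo hT₄.1.le le_rfl
  -- ### the far field: vanishing vorticity (Steps 2–3) and the `L^∞` bound
  obtain ⟨Rf, Uf, hUf1, hUfv, hcurl⟩ :=
    localLeray_farField_curl_eq_zero_slab_of_farField_vanishing
      NSBoundedHigherRegularityBounds_holds one_pos hdiv hv hfinal hT₄
  obtain ⟨Rb, hRb⟩ :=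
    hv.farField_bound_anyDatum one_pos hT₄.1 (le_refl T)
  have hfar := ae_norm_le_toReal_of_eLpNorm_top_lt_top hRb
  -- ### a.e. time is regular; around each regular time a strip where `v` vanishes
  have hreg : ∀ᵐ t ∂(volume.restrict (Ioo T₄ T)), ∀ x : EuclideanSpace ℝ (Fin 3),
      IsRegularPoint v (t, x) :=
    ae_restrict_of_ae_restrict_of_subset hI₄ (ae_forall_isRegularPoint_slab one_pos hv.suitable)
  have hstrip : ∀ᵐ t ∂(volume.restrict (Ioo T₄ T)), ∃ q : ℚ × ℚ, t ∈ Ioo (q.1 : ℝ) q.2 ∧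
      ∀ᵐ z ∂(volume.restrict (Ioo (q.1 : ℝ) q.2 ×ˢ (univ : Set (EuclideanSpace ℝ (Fin 3))))),
        v z.1 z.2 = 0 := by
    filter_upwards [hreg, ae_restrict_mem measurableSet_Ioo] with t ht htI
    obtain ⟨τ, hτ, hsubτ, L, hL⟩ := exists_strip_bound_Ioo hfar (fun x _ => ht x) htI
    obtain ⟨h1, h2⟩ := (Ioo_subset_Ioo_iff (by linarith : t - τ < t + τ)).1 hsubτ
    -- the strip lemma on `(t - τ, t + τ/2)`, which vanishes on `(t - τ/4, t + τ/2) ∋ t`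
    have ha : 0 < t - τ := lt_of_lt_of_le hT₄.1 h1
    have hab : t - τ < t + τ / 2 := by linarith
    have hbT : t + τ / 2 ≤ T := by linarith
    have hJ : Ioo (t - τ) (t + τ / 2) ⊆ Ioo T₄ T := Ioo_subset_Ioo h1 (by linarith)
    have hbd : ∀ᵐ z ∂(volume.restrict
        (Ioo (t - τ) (t + τ / 2) ×ˢ (univ : Set (EuclideanSpace ℝ (Fin 3))))), ‖v z.1 z.2‖ ≤ L :=
      ae_restrict_of_ae_restrict_of_subset
        (prod_mono (Ioo_subset_Ioo le_rfl (by linarith)) Subset.rfl) hL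
    have hz := ae_zero_strip_of_farField_curl_eq_zero NSBoundedHigherRegularityBounds_holds
      kangMiuraTsai_local_pressure_bound_holds hdiv hv ha hab hbT hbd
      (fun s hs => hUf1 s (hJ hs))
      (ae_restrict_of_ae_restrict_of_subset (prod_mono hJ Subset.rfl) hUfv)
      (fun s hs x hx => hcurl s (hJ hs) x hx)
    obtain ⟨q₁, hq₁a, hq₁t⟩ := exists_rat_btwn (show t - τ / 4 < t by linarith)
    obtain ⟨q₂, hq₂t, hq₂b⟩ := exists_rat_btwn (show t < t + τ / 2 by linarith)
    refine ⟨(q₁, q₂), ⟨hq₁t, hq₂t⟩, ae_restrict_of_ae_restrict_of_subset (prod_mono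
      (Ioo_subset_Ioo (by linarith) hq₂b.le) Subset.rfl) hz⟩
  -- ### the countable union of the good rational strips carries a.e. every time
  set G : Set (ℚ × ℚ) := {q | ∀ᵐ z ∂(volume.restrict
    (Ioo (q.1 : ℝ) q.2 ×ˢ (univ : Set (EuclideanSpace ℝ (Fin 3))))), v z.1 z.2 = 0} with hG
  set S : Set ℝ := ⋃ q ∈ G, Ioo (q.1 : ℝ) q.2 with hSdef
  have hS : ∀ᵐ z ∂(volume.restrict (S ×ˢ (univ : Set (EuclideanSpace ℝ (Fin 3))))),
      v z.1 z.2 = 0 := by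
    have e : S ×ˢ (univ : Set (EuclideanSpace ℝ (Fin 3))) =
        ⋃ q ∈ G, Ioo (q.1 : ℝ) q.2 ×ˢ (univ : Set (EuclideanSpace ℝ (Fin 3))) := by
      rw [hSdef]
      simp only [iUnion_prod_const]
    rw [e, ae_restrict_biUnion_iff _ (Set.to_countable G)]
    exact fun q hq => hq
  have hnull : volume (Ioo T₄ T \ S) = 0 := by
    refine measure_eq_zero_iff_ae_notMem.2 ?_
    have h := (ae_restrict_iff' measurableSet_Ioo).1 hstrip
    filter_upwards [h] with t ht hmem
    obtain ⟨q, hq, hqG⟩ := ht hmem.1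
    exact hmem.2 (mem_iUnion₂.2 ⟨q, hqG, hq⟩)
  -- ### conclusion
  have hcover : Ioo T₄ T ×ˢ (univ : Set (EuclideanSpace ℝ (Fin 3))) ⊆
      S ×ˢ (univ : Set (EuclideanSpace ℝ (Fin 3))) ∪
        (Ioo T₄ T \ S) ×ˢ (univ : Set (EuclideanSpace ℝ (Fin 3))) := by
    rintro ⟨t, x⟩ ⟨ht, -⟩
    by_cases hts : t ∈ S
    · exact Or.inl ⟨hts, mem_univ _⟩
    · exact Or.inr ⟨⟨ht, hts⟩, mem_univ _⟩
  refine ae_restrict_of_ae_restrict_of_subset hcover ?_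
  rw [ae_restrict_union_iff]
  refine ⟨hS, ?_⟩
  have h0 : volume ((Ioo T₄ T \ S) ×ˢ (univ : Set (EuclideanSpace ℝ (Fin 3)))) = 0 := by
    rw [Measure.volume_eq_prod, Measure.prod_prod, hnull, zero_mul]
  rw [Measure.restrict_eq_zero.2 h0, ae_zero]
  exact eventually_bot

/-- **Backward uniqueness for slab local Leray solutions from the far field of the final value,
viscosity `ν > 0`** (Lemarié-Rieusset 2016, Thm. 15.4, PDF p. 568, final value vanishing only
outside a ball): if `(v, π)` is a local Leray solution on `(0, T) × ℝ³` with viscosity `ν` and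
weakly divergence-free datum, and `∫⟪v(t), φ⟫ → 0` as `t ↑ T` for every test field `φ` supported
in `{|x| > R₁}`, then `v = 0` a.e. on `(0, T) × ℝ³`. From the unit-viscosity statement by the slab
viscosity scaling `IsLocalLeraySolutionOn.toUnitViscosity` (`ṽ(s, y) = ν⁻¹ v(ν⁻¹ s, y)` on
`(0, νT)`; the scaling does not move space, so the support condition is unchanged), exactly as in
the tree's `ae_zero_of_final_vanishing_anyDatum`. [cite: LemarieRieusset2016, Thm. 15.4 (PDF p. 568)] -/
theorem IsLocalLeraySolutionOn.ae_zero_of_farField_final_vanishing {ν T : ℝ} (hν : 0 < ν)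
    (hT : 0 < T) {u₀ : EuclideanSpace ℝ (Fin 3) → EuclideanSpace ℝ (Fin 3)}
    {v : ℝ → EuclideanSpace ℝ (Fin 3) → EuclideanSpace ℝ (Fin 3)}
    {π : ℝ → EuclideanSpace ℝ (Fin 3) → ℝ}
    (hdiv : IsWeaklyDivFree u₀) (hv : IsLocalLeraySolutionOn T ν u₀ v π) {R₁ : ℝ}
    (hfinal : ∀ φ : EuclideanSpace ℝ (Fin 3) → EuclideanSpace ℝ (Fin 3),
      FunctionSpaces.IsTestFunctionOn (⊤ : Opens (EuclideanSpace ℝ (Fin 3))) φ →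
        (∀ x, φ x ≠ 0 → R₁ < ‖x‖) →
        Tendsto (fun t => ∫ x, ⟪v t x, φ x⟫) (𝓝[<] T) (𝓝 0)) :
    ∀ᵐ z ∂(volume.restrict (Ioo 0 T ×ˢ (univ : Set (EuclideanSpace ℝ (Fin 3))))),
      v z.1 z.2 = 0 := by
  have hw := hv.toUnitViscosity hν
  have hdiv' : IsWeaklyDivFree (ν⁻¹ • u₀) := hdiv.const_smul _
  have hνT : 0 < ν * T := mul_pos hν hT
  -- the final-value hypothesis for the normalised solution
  have hfinal' : ∀ φ : EuclideanSpace ℝ (Fin 3) → EuclideanSpace ℝ (Fin 3),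
      FunctionSpaces.IsTestFunctionOn (⊤ : Opens (EuclideanSpace ℝ (Fin 3))) φ →
        (∀ x, φ x ≠ 0 → R₁ < ‖x‖) →
        Tendsto (fun s => ∫ x, ⟪FluidPDE.timeRescale ν⁻¹ ν⁻¹ v s x, φ x⟫)
          (𝓝[<] (ν * T)) (𝓝 0) := by
    intro φ hφ hφsupp
    have e : (fun s => ∫ x, ⟪FluidPDE.timeRescale ν⁻¹ ν⁻¹ v s x, φ x⟫) =
        fun s => ν⁻¹ * ∫ x, ⟪v (ν⁻¹ * s) x, φ x⟫ := by
      funext s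
      simp only [timeRescale_apply, real_inner_smul_left]
      exact integral_const_mul _ _
    rw [e]
    have hmap : Tendsto (fun s : ℝ => ν⁻¹ * s) (𝓝[<] (ν * T)) (𝓝[<] T) := by
      have hc : ContinuousWithinAt (fun s : ℝ => ν⁻¹ * s) (Iio (ν * T)) (ν * T) :=
        (continuous_const.mul continuous_id).continuousWithinAt
      have hm : MapsTo (fun s : ℝ => ν⁻¹ * s) (Iio (ν * T)) (Iio T) := by
        intro s hs
        have h : ν⁻¹ * s < ν⁻¹ * (ν * T) := mul_lt_mul_of_pos_left hs (inv_pos.2 hν)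
        rwa [← mul_assoc, inv_mul_cancel₀ hν.ne', one_mul] at h
      have h := hc.tendsto_nhdsWithin hm
      rwa [← mul_assoc, inv_mul_cancel₀ hν.ne', one_mul] at h
    have h := ((hfinal φ hφ hφsupp).comp hmap).const_mul ν⁻¹
    rw [mul_zero] at h
    exact h
  have h := IsLocalLeraySolutionOn.ae_zero_of_farField_final_vanishing_unit hνT hdiv' hw hfinal'
  -- transport back along `(t, x) ↦ (ν t, x)`
  have h2 := ae_restrict_preimage_stAffine hν one_pos 0 (0 : EuclideanSpace ℝ (Fin 3)) h
  rw [stAffine_preimage_Ioo_zero_prod hν T] at h2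
  filter_upwards [h2] with z hz
  have hz' : ν⁻¹ • v (ν⁻¹ * (0 + ν * z.1)) (0 + (1 : ℝ) • z.2) = 0 := hz
  rw [zero_add, zero_add, one_smul, ← mul_assoc, inv_mul_cancel₀ hν.ne', one_mul] at hz'
  exact (smul_eq_zero.1 hz').resolve_left (inv_ne_zero hν.ne')

end Literature.Analysis.FluidPDE

end
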